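import Literature.MathematicalPhysics.QuantumFieldTheory.Balaban1983to89.B15Prop1GradientFromNearValue
import Literature.MathematicalPhysics.QuantumFieldTheory.Balaban1983to89.B15Eq177ValueInvarianceB

/-!
# `Balaban1983to89.B15Prop1GradientFromNearValueB` — [Balaban1988Convergent] (= [III]) (1.12) p. 248, (2.12)–(2.13) pp. 256–257; [Balaban1984PropagatorsII] (= [II]) (2.3) p. 224;
# [Balaban1989LargeFieldI] (= [B15]) (1.74) p. 192, (1.77) p. 194; [Balaban1989LargeFieldII] (1.15) p. 359: THE PINNING OF A (2.12) MINIMISER OFF `Ω₁(Z)` AND THE NEAR ∕ FAR DICHOTOMY OF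
# (1.77) **OVER A BOND-LEVEL DATUM** — the print-datum edition of the two declarations of `B15Prop1GradientFromNearValue` with a datum-bearing statement that N12's junction of record
# uses (`isMinimizer_pinned`, `fun177std_dichotomy`) (THEOREMS ONLY)

statement-level skeleton of published theorems with citation tags; proofs where landed; nothing here is a claim about
the Yang–Mills mass gap

Cell `pub-ymgap` (HUMAN RULINGS D-0062 ∕ D-0149), lane `pub-ymgap-dag-n12-c` g35 (R134 seat (a), N12 = [B15], s1); `--kind proof --supports` K1⁹ `stmt-QuantumFields-27364`;
count-neutral.  THEOREMS ONLY (0 `def`, 0 `instance`, 0 `sorry`).  (E1) variant (iii-b), class (β) of the lane's census-by-declaration (bus [DAGN12C-G35], 2026-08-30).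

THE ONE PLACE WHERE PRINT's DATUM CHANGES A STATEMENT (LOCATED, bookkeeping-sized).  Reading (b) constrains at scale `0` every bond MEETING `Γ₀ = Ω₁ᶜ` ([I] p. 251), so a (2.12) minimiser
with data `M˙(W)` is pinned to `W` on every bond STARTING outside `Ω₁(Z)` (`isMinimizer_pinned`).  Print's [II] (2.3) `Λ₀ = st(Ω₁ᶜ⁽⁰⁾) ∖ st(Ω₁⁽⁰⁾)` drops the INWARD CONNECTORS
(ruling (α) of record; F0a `mem_lamBondsSeq_iff_zero`): a bond from `Ω₁ᶜ` into `Ω₁` is a FREE variable.  Hence over a bond datum the pinning holds on the bonds with BOTH end-points outside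
`Ω₁(Z)` (§1, under the displayed level-`0` hypothesis `h𝔅 ∕ hbd0`, discharged for both families of record in §1), and that is exactly what the far ∕ near bookkeeping needs: a plaquette
WITHOUT a corner in `Ω₁(Z)` reads only bonds whose both end-points are corners (§0 `plaqHol_congr_of_not_mem_plaqsOf₂`).  The dichotomy (§2) is then the parent's, verbatim.

HONESTY GUARD (director-ym №338 (5)).  PURELY ADDITIVE: the (b)-keyed parent stays landed and true on its own text; node00-def-R's S2a names (`bgOfRecordB ∕ UminOfRecordB ∕
isMinimizerB_UminOfRecordB ∕ UminOfRecordB_of_not`) and the lane's F ∕ O are consumed by name; the parent's datum-free lemmas (`wilsonLoc_congr`, `qsstarGIter0_expMul_ιA_of_far`,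
`wilsonAction4_one_cfg`, `wilsonLoc_one_cfg`, `wilsonLoc_nonneg`, `eq115`) are REUSED.  No displayed premise of any consumer is deleted or weakened; the new level-`0` binder is displayed.

WHAT IS HERE.
* §0 `plaqHol_congr_of_not_mem_plaqsOf₂` (agreement on the bonds with both end-points outside `Y` ⇒ equal plaquette variables off `plaqsOf Y`).
* §1 ★ `IsMinimizerB.pinned₂` (generic bond datum, displayed level-`0` clause `h𝔅`) · `mem_genSetDatumP_zero_of_not_mem` (reading (b): `b.src ∉ Ω₁` suffices) ·
  ★ `mem_lamDatumP_zero_of_not_mem₂` (print: both end-points outside `Ω₁`, `Ω₁` a union of `1`-blocks) · `mem_lamDatumP_maxDomT_zero_of_not_mem₂` (at `Z`'s maximal sequence, r11's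
  `isBlockUnion_maxDomT`) · `farValue_eq_of_pinned₂` (far actions of two configurations pinned off `Ω₁(Z)` agree).
* §2 ★★ `fun177stdB_dichotomy` (the parent's (1.77) near ∕ far dichotomy at `Node00.bgOfRecordB av reg` over a bond-datum family `bd`, level-`0` clause `hbd0` displayed) ·
  `fun177stdB_dichotomy_lamDatumP` (print's family at `Z`'s maximal sequence: the clause discharged).

HONEST SCOPE.  Elementary bookkeeping; nothing of [15] Thm 1 asserted or used; count-neutral; N12 NOT discharged; K0⁷ ∕ K1⁹ NOT closed; one finite 𝕋⁴ programme at fixed ε — nothing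
continuum ∕ ℝ⁴ ∕ OS; the Yang–Mills mass gap (Clay) is NOT proved by any of this.

References: [III] = [Balaban1988Convergent] (1.12) p.248, (2.2) p.255, (2.12)–(2.13) pp.256–257; [II] = [Balaban1984PropagatorsII] (2.3) p.224; [B15] = [Balaban1989LargeFieldI] (1.74) p.192, (1.77)
p.194; [Balaban1989LargeFieldII] (1.1) p.356, (1.15) p.359; [I] = [Balaban1987RG1] (0.1) p.251; [Balaban1985RegularSpaces] p.77.
-/

noncomputable section

open Set Finset Metric Filter
open scoped BigOperators Matrix RealInnerProductSpace Real InnerProductSpace Topology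

namespace Literature.MathematicalPhysics.QuantumFieldTheory.Balaban1983to89.B15Prop1GradientFromNearValue

open B15DeterminingSets B15DeterminingSetsB GaugeField B16Sect1Backgrounds B15Prop1Carrier B8Eq17ClassAkV1
open B15Prop1SliceTaylorCalculus B15Prop1LocalLettersOfFun B15Prop1IntrinsicOfFun
open B15Prop1ChartCalculusSU2 (E3)
open T4CubeChartGnomonic (SU2)
open B15Prop1ChartSU2 (su2Chart)
open B15Prop1SliceCoordinates (GaugeSlice ιA freeBonds)
open B14.Eq213DetSet B14.Eq216Concrete B15Sect1Instances B15Eq177GaugeInvariance B15Eq177ValueInvariance B16Sect1Wilson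
open B14.Eq22Determines (blockIter IsBlockUnion mem_iff_blockIter_mem_pts)
open B14.Eq213MaximalDomains (side)
open Literature.MathematicalPhysics.QuantumFieldTheory.BalabanImbrieJaffe1984to88.BIJ85Eq453GaugeField

/-! ## §0  Plaquettes off `Y` read only bonds with BOTH end-points off `Y` -/

section Plaquettes

variable {P : Params} {j : ℕ}

/-- `(x + e_μ) + e_ν = (x + e_ν) + e_μ` on the periodic lattice. [folklore] -/
private theorem shift_shift_comm (x : Site P j) (μ ν : Fin P.d) : (x.shift μ).shift ν = (x.shift ν).shift μ := by
  funext κ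
  by_cases h1 : κ = ν
  · subst h1
    by_cases h2 : κ = μ
    · subst h2; rfl
    · simp [Site.shift, Function.update_of_ne h2]
  · by_cases h2 : κ = μ
    · subst h2
      simp [Site.shift, Function.update_of_ne h1]
    · simp [Site.shift, Function.update_of_ne h1, Function.update_of_ne h2]

/-- Two configurations agreeing on every bond with BOTH end-points outside a site set `Y` have the same plaquette variable at every plaquette WITHOUT a corner in `Y` (the four bonds of such a
plaquette run between corners); the both-end-points edition of the parent's `plaqHol_congr_of_not_mem_plaqsOf`, which is what print's [II] (2.3) datum pins (§1).
[cite: Balaban1985RegularSpaces, p.77 (convention before (1.5)); Balaban1984PropagatorsII, (2.3) p.224] -/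
theorem plaqHol_congr_of_not_mem_plaqsOf₂ {G : Type*} [GaugeGroup G] {Y : Set (Site P j)} {U U' : GaugeField P j G}
    (hU : ∀ b : PBond P j, b.src ∉ Y → b.tgt ∉ Y → U b = U' b) {p : Plaq P j} (hp : p ∉ plaqsOf Y) : plaqHol U p = plaqHol U' p := by
  simp only [mem_plaqsOf, not_or] at hp
  obtain ⟨h1, h2, h3, h4⟩ := hp
  have h4' : (p.src.shift p.ν).shift p.μ ∉ Y := by rw [← shift_shift_comm]; exact h4
  simp only [plaqHol, hU ⟨p.src, p.μ⟩ h1 h2, hU ⟨p.src.shift p.μ, p.ν⟩ h2 h4, hU ⟨p.src.shift p.ν, p.μ⟩ h3 h4', hU ⟨p.src, p.ν⟩ h1 h3]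

end Plaquettes

/-! ## §1  A bond-datum (2.12) minimiser is pinned to its scale-`0` datum on the bonds with both end-points off `Ω₁(Z)` -/

section Pinned

variable {P : Params} {G : Type*} [GaugeGroup G]

/-- ★ **A BOND-DATUM MINIMISER IS PINNED TO ITS SCALE-`0` DATUM**: if the bond datum `𝔅` contains at level `0` every bond with both end-points outside `Y` (displayed clause `h𝔅`; for print's
[II] (2.3) datum at `Z`'s maximal sequence `Y = Ω₁(Z)`, §1 below), then a minimal configuration of (2.12) for `𝔅` and the data `M˙(W)` agrees with `W` on every such bond (the scale-`0`
averaging is the identity); both-end-points edition of `isMinimizer_pinned`. [cite: Balaban1988Convergent, (1.12) p.248, (2.12) p.256; Balaban1984PropagatorsII, (2.3) p.224] -/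
theorem IsMinimizerB.pinned₂ {av : ∀ j, Averaging P j G} {reg : Set (GaugeField P 0 G)} {𝔅 : BDetSet P} {Y : Set (Site P 0)}
    (h𝔅 : ∀ b : PBond P 0, b.src ∉ Y → b.tgt ∉ Y → b ∈ 𝔅 0) {W U₀ : GaugeField P 0 G} (hmin : IsMinimizerB av reg 𝔅 (avgFamily av W) U₀)
    (b : PBond P 0) (hs : b.src ∉ Y) (ht : b.tgt ∉ Y) : U₀ b = W b :=
  hmin.2.1 0 b (h𝔅 b hs ht)

/-- READING (b)'s family satisfies the level-`0` clause with room to spare (`b.src ∉ Ω₁` alone puts `b` among the bonds meeting `Γ₀ = Ω₁ᶜ`), `0 < k`.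
[cite: Balaban1988Convergent, (2.2) p.255, (2.13) pp.256–257; Balaban1987RG1, (0.1) p.251] -/
theorem mem_genSetDatumP_zero_of_not_mem (Ω : ℕ → Set (Site P 0)) {k : ℕ} (hk : 0 < k) (b : PBond P 0) (hs : b.src ∉ Ω 1) :
    b ∈ (genSetDatumP k Ω : BDetSet P) 0 := by
  show b ∈ bondsOf (genSet Ω k 0)
  simp only [bondsOf, genSet, gammaRegion_zero Ω hk, pts_zero, Set.mem_setOf_eq]
  exact Or.inl hs

/-- ★ **PRINT's [II] (2.3) FAMILY SATISFIES THE LEVEL-`0` CLAUSE**: if `Ω₁` is a union of `1`-blocks and `0 < k`, a bond with BOTH end-points outside `Ω₁` is a bond of `Λ₀` (it meets `Ω₁ᶜ`,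
and neither end-point is deep in `Ω₁`: for a block union «`blockOf y ∈ Ω₁⁽¹⁾`» iff «`y ∈ Ω₁`», r11's `mem_iff_blockIter_mem_pts`).  A bond from `Ω₁ᶜ` INTO `Ω₁` is NOT (inward
connector, F0a `not_mem_lamBondsSeq_of_deep`) — the located difference to reading (b). [cite: Balaban1984PropagatorsII, (2.3) p.224; Balaban1988Convergent, (2.2) p.255] -/
theorem mem_lamDatumP_zero_of_not_mem₂ (Ω : ℕ → Set (Site P 0)) {k : ℕ} (hk : 0 < k) (hΩ : IsBlockUnion 1 (Ω 1))
    (b : PBond P 0) (hs : b.src ∉ Ω 1) (ht : b.tgt ∉ Ω 1) : b ∈ (lamDatumP k Ω : BDetSet P) 0 := by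
  show b ∈ lamBondsSeq Ω k 0
  rw [mem_lamBondsSeq_iff_zero Ω k hk]
  refine ⟨Or.inl hs, ?_, ?_⟩
  · exact fun h => hs ((mem_iff_blockIter_mem_pts hΩ b.src).2 h)
  · exact fun h => ht ((mem_iff_blockIter_mem_pts hΩ b.tgt).2 h)

/-- The level-`0` clause for print's family AT `Z`'s MAXIMAL SEQUENCE (`Ω₁(Z) = maxDomT M₁ Z 1` is a union of `1`-blocks under print's `1 ≤ M₁`, the torus divisibility and `1 ≤ k ≤ m + K`:
r11's `isBlockUnion_maxDomT`). [cite: Balaban1984PropagatorsII, (2.3) p.224; Balaban1988Convergent, (2.13) pp.256–257] -/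
theorem mem_lamDatumP_maxDomT_zero_of_not_mem₂ {M₁ : ℕ} (hM : 1 ≤ M₁) {Z : Set (Site P 0)} {k : ℕ} (hk : 0 < k) (hkK : k ≤ P.m + P.K)
    (hdiv : side P.L M₁ k ∣ P.sitesPerDir 0) (b : PBond P 0) (hs : b.src ∉ maxDomT M₁ Z 1) (ht : b.tgt ∉ maxDomT M₁ Z 1) :
    b ∈ (lamDatumP k (maxDomT M₁ Z) : BDetSet P) 0 :=
  mem_lamDatumP_zero_of_not_mem₂ (maxDomT M₁ Z) hk (isBlockUnion_maxDomT hM hdiv le_rfl hk (le_trans hk hkK)) b hs ht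

/-- Two configurations pinned to one `W` on the bonds with both end-points outside `Ω₁(Z)` have the same FAR action (any weight vanishing on the plaquettes meeting `Ω₁(Z)`).
[cite: Balaban1989LargeFieldII, (1.1) p.356, (1.15) p.359; Balaban1988Convergent, (1.12) p.248] -/
theorem farValue_eq_of_pinned₂ {j : ℕ} {Y : Set (Site P j)} {W U₁ U₂ : GaugeField P j G}
    (h₁ : ∀ b : PBond P j, b.src ∉ Y → b.tgt ∉ Y → U₁ b = W b) (h₂ : ∀ b : PBond P j, b.src ∉ Y → b.tgt ∉ Y → U₂ b = W b)
    (ζ : Plaq P j → ℝ) (hζ : ∀ p, ζ p ≠ 0 → p ∉ plaqsOf Y) : wilsonLoc ζ U₁ = wilsonLoc ζ U₂ :=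
  wilsonLoc_congr ζ fun p hp =>
    plaqHol_congr_of_not_mem_plaqsOf₂ (fun b hs ht => by rw [h₁ b hs ht, h₂ b hs ht]) (hζ p hp)

end Pinned

/-! ## §2  The near ∕ far dichotomy of (1.77) at node00-def-R's bond-level solution map of record -/

section DichotomyB

open Classical

variable {P : Params}

/-- ★★ **THE DICHOTOMY LETTER AT THE BOND-LEVEL SOLUTION MAP OF RECORD** `Node00.bgOfRecordB av reg`, over a bond-datum family `bd` whose level-`0` member at `(k, {Ω_j(Z)})` contains every
bond with both end-points outside `Ω₁(Z)` (clause `hbd0`; §1), `0 < k ≤ m + K`, the geometric letter `hfar`, any datum `V`: with `A_near(U) = Σ_{p ∈ plaqsOf Ω₁(Z)} (1 − Re tr U(∂p))` and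
`C = A_far(Q_k^{s*}V) ≥ 0`, at EVERY slice point `X` either the (1.74) problem for `exp(i·ιA X)·V` on the bonds `bd k {Ω_j(Z)}` is unsolvable and `A(U_{k,Z}) = A_near(U_{k,Z}) = 0` (junk
branch `Node00.UminOfRecordB_of_not`), or it is solvable and `A(U_{k,Z}) = A_near(U_{k,Z}) + C` (`eq115`; the far plaquettes read only pinned bonds, §1, and the pinned datum does not read `X`,
`qsstarGIter0_expMul_ιA_of_far`); twin of `fun177std_dichotomy`. [cite: Balaban1989LargeFieldI, (1.74) p.192, (1.77) p.194; Balaban1985Variational, (5) p.278; Balaban1988Convergent, (2.12)–(2.13) p.256–257; Balaban1984PropagatorsII, (2.3) p.224] -/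
theorem fun177stdB_dichotomy (av : ∀ j, Averaging P j SU2) (reg : Set (GaugeField P 0 SU2)) (M₁ : ℕ)
    (bd : ℕ → (ℕ → Set (Site P 0)) → BDetSet P) {Z Λ : Set (Site P 0)} {k : ℕ} (hk : k ≤ P.m + P.K) (T : Finset (PBond P k))
    (hbd0 : ∀ b : PBond P 0, b.src ∉ maxDomT M₁ Z 1 → b.tgt ∉ maxDomT M₁ Z 1 → b ∈ bd k (maxDomT M₁ Z) 0)
    (hfar : ∀ b : PBond P 0, b.src ∉ maxDomT M₁ Z 1 → (⟨blockIter k b.src, b.dir⟩ : PBond P k) ∉ bondsOf (pts k Λ))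
    (V : GaugeField P k SU2) :
    ∃ C : ℝ, 0 ≤ C ∧ ∀ X : GaugeSlice (pts k Λ) T E3,
      (fun177stdB (Node00.bgOfRecordB av reg) M₁ bd Z k (expMul su2Chart (ιA (pts k Λ) T X) V) = 0 ∧
          wilsonLoc ((plaqsOf (maxDomT M₁ Z 1)).indicator fun _ => (1 : ℝ))
            (bgKZstdB (Node00.bgOfRecordB av reg) M₁ bd Z k (expMul su2Chart (ιA (pts k Λ) T X) V)) = 0) ∨
        fun177stdB (Node00.bgOfRecordB av reg) M₁ bd Z k (expMul su2Chart (ιA (pts k Λ) T X) V) =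
          wilsonLoc ((plaqsOf (maxDomT M₁ Z 1)).indicator fun _ => (1 : ℝ))
            (bgKZstdB (Node00.bgOfRecordB av reg) M₁ bd Z k (expMul su2Chart (ιA (pts k Λ) T X) V)) +
          C := by
  -- the far weight `1 − 1_{near}` is nonnegative and vanishes on the near plaquettes
  have hζfar : ∀ p : Plaq P 0, 1 - (plaqsOf (maxDomT M₁ Z 1)).indicator (fun _ => (1 : ℝ)) p ≠ 0 → p ∉ plaqsOf (maxDomT M₁ Z 1) := by
    intro p hp hmem
    apply hp
    simp only [Set.indicator_of_mem hmem, sub_self]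
  have hζle : ∀ p : Plaq P 0, 0 ≤ 1 - (plaqsOf (maxDomT M₁ Z 1)).indicator (fun _ => (1 : ℝ)) p := by
    intro p
    by_cases hmem : p ∈ plaqsOf (maxDomT M₁ Z 1)
    · simp only [Set.indicator_of_mem hmem, sub_self, le_refl]
    · simp only [Set.indicator_of_notMem hmem, sub_zero, zero_le_one]
  refine ⟨wilsonLoc (fun p => 1 - (plaqsOf (maxDomT M₁ Z 1)).indicator (fun _ => (1 : ℝ)) p) (qsstarGIter0 k V),
    wilsonLoc_nonneg _ _ hζle, fun X => ?_⟩
  -- the background of the perturbed datum is the bond-level solution map of record at the data `M˙(Q_k^{s*}(exp(i·ιA X)·V))`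
  have hU : bgKZstdB (Node00.bgOfRecordB av reg) M₁ bd Z k (expMul su2Chart (ιA (pts k Λ) T X) V) =
      Node00.UminOfRecordB av reg (bd k (maxDomT M₁ Z)) (avgFamily av (qsstarGIter0 k (expMul su2Chart (ιA (pts k Λ) T X) V))) := by
    rw [bgKZstdB_apply, Node00.bgOfRecordB_U]
  by_cases hsol : ∃ U₀, IsMinimizerB av reg (bd k (maxDomT M₁ Z)) (avgFamily av (qsstarGIter0 k (expMul su2Chart (ιA (pts k Λ) T X) V))) U₀
  · -- solvable: total action = near action + far action of the pinned pull-back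
    right
    have hmin := Node00.isMinimizerB_UminOfRecordB av reg hsol
    -- far plaquettes read only bonds with both end-points outside `Ω₁(Z)`, where the minimiser is pinned to the datum, and the datum there does not read `X`
    have h1 : wilsonLoc (fun p => 1 - (plaqsOf (maxDomT M₁ Z 1)).indicator (fun _ => (1 : ℝ)) p)
        (Node00.UminOfRecordB av reg (bd k (maxDomT M₁ Z)) (avgFamily av (qsstarGIter0 k (expMul su2Chart (ιA (pts k Λ) T X) V)))) =
        wilsonLoc (fun p => 1 - (plaqsOf (maxDomT M₁ Z 1)).indicator (fun _ => (1 : ℝ)) p)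
          (qsstarGIter0 k (expMul su2Chart (ιA (pts k Λ) T X) V)) :=
      wilsonLoc_congr _ fun p hp => plaqHol_congr_of_not_mem_plaqsOf₂ (fun b hs ht => IsMinimizerB.pinned₂ hbd0 hmin b hs ht) (hζfar p hp)
    have h2 : wilsonLoc (fun p => 1 - (plaqsOf (maxDomT M₁ Z 1)).indicator (fun _ => (1 : ℝ)) p)
        (qsstarGIter0 k (expMul su2Chart (ιA (pts k Λ) T X) V)) =
        wilsonLoc (fun p => 1 - (plaqsOf (maxDomT M₁ Z 1)).indicator (fun _ => (1 : ℝ)) p) (qsstarGIter0 k V) :=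
      wilsonLoc_congr _ fun p hp =>
        plaqHol_congr_of_not_mem_plaqsOf (fun b hb => qsstarGIter0_expMul_ιA_of_far hk hfar X V b hb) (hζfar p hp)
    rw [fun177stdB_eq, hU, eq115 ((plaqsOf (maxDomT M₁ Z 1)).indicator fun _ => (1 : ℝ)), h1, h2]
  · -- unsolvable: the junk branch `1`, both actions vanish
    left
    have h1 : Node00.UminOfRecordB av reg (bd k (maxDomT M₁ Z)) (avgFamily av (qsstarGIter0 k (expMul su2Chart (ιA (pts k Λ) T X) V))) =
        fun _ => 1 := Node00.UminOfRecordB_of_not av reg hsol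
    rw [fun177stdB_eq, hU, h1]
    exact ⟨wilsonAction4_one_cfg, wilsonLoc_one_cfg _⟩

/-- **THE DICHOTOMY AT PRINT'S [II] (2.3) FAMILY `lamDatumP`**, `0 < k ≤ m + K`, `1 ≤ M₁`, the torus divisibility: the level-`0` clause discharged by `mem_lamDatumP_maxDomT_zero_of_not_mem₂`.
[cite: Balaban1989LargeFieldI, (1.74) p.192, (1.77) p.194; Balaban1984PropagatorsII, (2.3) p.224; Balaban1988Convergent, (2.13) pp.256–257] -/
theorem fun177stdB_dichotomy_lamDatumP (av : ∀ j, Averaging P j SU2) (reg : Set (GaugeField P 0 SU2)) {M₁ : ℕ} (hM : 1 ≤ M₁)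
    {Z Λ : Set (Site P 0)} {k : ℕ} (hk0 : 0 < k) (hk : k ≤ P.m + P.K) (hdiv : side P.L M₁ k ∣ P.sitesPerDir 0) (T : Finset (PBond P k))
    (hfar : ∀ b : PBond P 0, b.src ∉ maxDomT M₁ Z 1 → (⟨blockIter k b.src, b.dir⟩ : PBond P k) ∉ bondsOf (pts k Λ))
    (V : GaugeField P k SU2) :
    ∃ C : ℝ, 0 ≤ C ∧ ∀ X : GaugeSlice (pts k Λ) T E3,
      (fun177stdB (Node00.bgOfRecordB av reg) M₁ lamDatumP Z k (expMul su2Chart (ιA (pts k Λ) T X) V) = 0 ∧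
          wilsonLoc ((plaqsOf (maxDomT M₁ Z 1)).indicator fun _ => (1 : ℝ))
            (bgKZstdB (Node00.bgOfRecordB av reg) M₁ lamDatumP Z k (expMul su2Chart (ιA (pts k Λ) T X) V)) = 0) ∨
        fun177stdB (Node00.bgOfRecordB av reg) M₁ lamDatumP Z k (expMul su2Chart (ιA (pts k Λ) T X) V) =
          wilsonLoc ((plaqsOf (maxDomT M₁ Z 1)).indicator fun _ => (1 : ℝ))
            (bgKZstdB (Node00.bgOfRecordB av reg) M₁ lamDatumP Z k (expMul su2Chart (ιA (pts k Λ) T X) V)) +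
          C :=
  fun177stdB_dichotomy av reg M₁ lamDatumP hk T (fun b hs ht => mem_lamDatumP_maxDomT_zero_of_not_mem₂ hM hk0 hk hdiv b hs ht) hfar V

end DichotomyB

end Literature.MathematicalPhysics.QuantumFieldTheory.Balaban1983to89.B15Prop1GradientFromNearValue

end
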